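import Summits.BirchSwinnertonDyer.BirchSwinnertonDyer.Theorems.ByReductionTypeAtTwoTowerNoFiniteSubmoduleOfCasselsTateAlternating
import Literature.NumberTheory.EllipticCurves.CasselsTateLayerPairing
import Literature.NumberTheory.EllipticCurves.ZpCorankQuasiIso
import Literature.Algebra.Module.AlternatingPairingParity
import HarnessLib

/-!
# Route `ByReductionTypeAtTwo` (rung K4), TOWER road / crux `SupersingularRankZeroAtTwo` (item stmt-BirchSwinnertonDyer-19097):
# the HACHIMORI–MATSUNO criterion with «BOUNDED `ℤ_p`-CORANK of `Sel_{p^∞}(E/K_n)`» in place of «`X` is `Λ`-torsion»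
# — `X(E/K_∞)` has no non-zero finite `Λ`-submodule (Matsuno 2003 Prop. 4.1 / Kitajima–Otsuki 2018 Thm. 4.5 shape)

HONEST FRAMING (cell `bsd-2adic`, run/shared/lean/pub/bsd-2adic/, seat `bsd-2adic-tower-1` GEN 63, hand h11 of LEAD ss-1 GEN 23
`ss/gen23/HAND-TARGETS-NF-1.md` §1; HUMAN RULINGS D-0036 / D-0054 / D-0074): THEOREMS ONLY (no definition, no named fact, no instance,
no `sorry`, axioms the standard trio); CONDITIONAL on the displayed Cassels–Tate layer pairing (or the Literature NAMED FACT
`HachimoriMatsuno2000.casselsTate_layerPairing`, by name) and on the displayed corank bound; closes no route item; nothing booked;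
BSD is not proved by any of this.

WHAT IT PROVES. The GEN 21/22 files of this road (`…TowerNoFiniteSubmoduleOf{LayerPackage,CasselsTatePackage,CasselsTatePairings,
CasselsTateAlternating,Holds}`) put Hachimori–Matsuno's proof [HachimoriMatsuno2000, Theorem + Cor. (i)] on the tree's plain Selmer tower
`Sel_{p^∞}(E/K_n) = W.selmerLayer κ n →(layerToInfty)→ W.selmerInfty κ` in the kernel, the STABILISATION of the images of the divisible parts
`D_n ⊆ Sel_{p^∞}(E/K_n)` in `Sel_{p^∞}(E/K_∞)` being taken from «`X` finitely generated and `Λ`-TORSION» (p. 2540: "Since `X` is `Λ`-torsion,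
the `ℤ_p`-corank of `D_n` is bounded as `n` varies"). At a prime of (potentially) SUPERSINGULAR reduction `X(E/K_∞)` is NOT `Λ`-torsion
(Greenberg LNM 1716 Thm. 1.7), but Hachimori–Matsuno's proof uses torsion ONLY through that one sentence. THIS FILE re-keys the road on the
sentence itself — «the `ℤ_p`-corank of `Sel_{p^∞}(E/K_n)` is bounded as `n` varies» — in the tree's corank currency `zpCorank`
(`Literature.NumberTheory.EllipticCurves.zpCorank`, the currency of `WeierstrassCurve.selmerCorank`):

* §1 pure algebra (no duality, no `Λ`): an increasing chain `A_0 ≤ A_1 ≤ ⋯` of `p`-divisible subgroups of `p`-primary elements with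
  `#(A_n ⊓ S[p])` bounded is eventually constant (`exists_forall_le_antitone_of_card_inf_torsionBy_le`: the `p`-torsion chain
  `A_n ⊓ S[p]` is an increasing chain of finite subgroups of bounded order, hence eventually constant, and a `p`-divisible `A ≤ A'` with
  `A'[p] ⊆ A` contains the `p`-primary `A'`, `le_of_inf_torsionBy_le_of_pDivisible`, by induction on the exponent); bookkeeping
  `#(D ⊓ L[p]) = p ^ zpCorank D` for a `p`-divisible `D ≤ L` (`natCard_inf_torsionBy_eq_pow_zpCorank`) and `zpCorank D = zpCorank L` when
  `L/D` is finite (`zpCorank_addSubgroup_eq_of_finite_quotient`, the tree's `zpCorank_eq_of_shortExact_of_finite_right`).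
* §2 the tree's layers, ANY number field `K`, elliptic `W/K` with `E(K)[p] = 0`, ANY `ℤ_p`-extension `κ` with topological generator `γ`,
  ANY dual datum `D : W.SelmerDualData κ γ` (no finite-generation, no torsion hypothesis):
  `SelmerDualData.forall_finite_eq_bot_of_casselsTateAlternating_of_stationary` — (ALT)(KER)(GAL)(ADJ) Cassels–Tate pairings on the
  layers + the STATIONARITY of `res_∞(Sel_{p^∞}(E/K_n)_{div})` displayed ⟹ no non-zero finite `Λ`-submodule (GEN 21's
  `forall_finite_eq_bot_of_towerPackage` with `D_n :=` the divisible elements); ★ `…_of_casselsTateAlternating_of_corankBounded` — the same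
  with the stationarity REPLACED by `∃ B, ∀ n, zpCorank (Sel_{p^∞}(E/K_n)) p ≤ B` (§1: the right kernels are `p`-divisible with finite
  quotient by the tree's `finite_quot_and_isSquare_natCard_of_pairing`, so `#D_n[p] = p^{corank Sel_n} ≤ p^B`, and the images in
  `H¹(K_∞, E[p^∞])` have the same `p`-torsion count because `layerToInfty` is injective when `E(K)[p] = 0`);
  ★ `…_of_casselsTateLayerPairing_of_corankBounded` — the pairing supplied BY NAME from the Literature fact `casselsTate_layerPairing`.
* Nothing here is specific to `p = 2` or to `ℚ`; the good-supersingular-at-`2` instance (hand h11) is the sibling file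
  `…SupersingularClassicalNoFiniteSubmoduleAtTwo`.

References: [HachimoriMatsuno2000] Y. Hachimori, K. Matsuno, Proc. AMS 128 (2000) 2539–2541, Theorem, Cor. (i), proof p. 2540 L28–L45
(held `paper:doi-10-1090-s0002-9939-00-05452-6`); [Matsuno2003] K. Matsuno, J. Number Theory 99 (2003) 415–443, Prop. 4.1;
[KitajimaOtsuki2018] Tokyo J. Math. 41 (2018), Prop. 4.4, Thm. 4.5 (arXiv:1607.03612 p. 18); [GreenbergLNM1716] Thm. 1.7, §4 Prop. 4.14
(pp. 104–105); [MilneADT2006] I Thm. 6.13, Rem. 6.10; [SilvermanAEC2009] Thm. X.4.14.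
-/

set_option autoImplicit false
-- the Theorems namespace of this sub repeats the summit name by design (D-0017 nested layout: Summit.<S>.<Sub>)
set_option linter.dupNamespace false

noncomputable section

open scoped Classical AddSubgroup

universe u

namespace Summit.BirchSwinnertonDyer.BirchSwinnertonDyer.Theorems.TowerHaMa

open NumberField IsDedekindDomain Field WeierstrassCurve Literature.NumberTheory.EllipticCurves
  Literature.NumberTheory.EllipticCurves.ZpExtension Literature.NumberTheory.GaloisRepresentations
  Summit.BirchSwinnertonDyer.Rank1Residual

/-! ## §1 Pure algebra: chains of divisible subgroups with bounded `p`-torsion are stationary -/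

section Algebra

variable {S : Type*} [AddCommGroup S] (p : ℕ)

/-- **A `p`-divisible subgroup containing the `p`-torsion of a `p`-primary oversubgroup contains it**: if `A ≤ A'`, every element of
`A` is `p • a'` with `a' ∈ A`, every element of `A'` is killed by a power of `p`, and `A' ⊓ S[p] ≤ A`, then `A' ≤ A` (induction on the
exponent: `p • a ∈ A` gives `p • a = p • b` with `b ∈ A`, and `a − b ∈ A'[p] ⊆ A`). [folklore] -/
theorem le_of_inf_torsionBy_le_of_pDivisible {A A' : AddSubgroup S} (hle : A ≤ A')
    (hprim : ∀ a ∈ A', ∃ k : ℕ, p ^ k • a = 0) (hdiv : ∀ a ∈ A, ∃ a' ∈ A, p • a' = a)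
    (htors : A' ⊓ S[(p : ℤ)] ≤ A) : A' ≤ A := by
  have key : ∀ (k : ℕ) (a : S), a ∈ A' → p ^ k • a = 0 → a ∈ A := by
    intro k
    induction k with
    | zero =>
      intro a _ hk
      rw [pow_zero, one_smul] at hk
      rw [hk]
      exact A.zero_mem
    | succ k ih =>
      intro a ha hk
      have hpa : p • a ∈ A := ih (p • a) (A'.nsmul_mem ha p) (by rw [smul_smul, ← pow_succ, hk])
      obtain ⟨b, hb, hbp⟩ := hdiv _ hpa
      have hab : a - b ∈ A' ⊓ S[(p : ℤ)] := by
        refine AddSubgroup.mem_inf.mpr ⟨A'.sub_mem ha (hle hb), ?_⟩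
        rw [AddSubgroup.torsionBy.nsmul_iff, smul_sub, hbp, sub_self]
      rw [← sub_add_cancel a b]
      exact A.add_mem (htors hab) hb
  intro a ha
  obtain ⟨k, hk⟩ := hprim a ha
  exact key k a ha hk

/-- **Stationarity of divisible parts with bounded corank (Hachimori–Matsuno's "the `ℤ_p`-corank of `D_n` is bounded", read WITHOUT
`Λ`-torsion).** An increasing chain `A_0 ≤ A_1 ≤ ⋯` of subgroups of `S` consisting of `p`-primary elements, each `p`-divisible, whose
`p`-torsion subgroups `A_n ⊓ S[p]` are finite of order `≤ C`, is eventually constant: the orders `#(A_n ⊓ S[p])` are monotone and bounded,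
hence eventually constant, so `A_{n+1}[p] = A_n[p] ⊆ A_n` and `le_of_inf_torsionBy_le_of_pDivisible` applies. (For cofinitely generated
`p`-primary groups `#A[p] = p^{corank A}` on the divisible part, so this is "bounded `ℤ_p`-corank ⟹ the `D_n` stabilise",
[HachimoriMatsuno2000, p. 2540 L40–L42]; [KitajimaOtsuki2018, Prop. 4.4].) [cite: HachimoriMatsuno2000, proof of the Theorem (p. 2540 L40–L42)]
[cite: KitajimaOtsuki2018, Prop. 4.4 (arXiv:1607.03612 p. 18)] -/
theorem exists_forall_le_antitone_of_card_inf_torsionBy_le (A : ℕ → AddSubgroup S)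
    (hmono : ∀ n, A n ≤ A (n + 1)) (hprim : ∀ n, ∀ a ∈ A n, ∃ k : ℕ, p ^ k • a = 0)
    (hdiv : ∀ n, ∀ a ∈ A n, ∃ a' ∈ A n, p • a' = a)
    (hfin : ∀ n, Finite ↥(A n ⊓ S[(p : ℤ)])) {C : ℕ} (hcard : ∀ n, Nat.card ↥(A n ⊓ S[(p : ℤ)]) ≤ C) :
    ∃ m, ∀ n, m ≤ n → A (n + 1) ≤ A n := by
  have hTmono : ∀ n, A n ⊓ S[(p : ℤ)] ≤ A (n + 1) ⊓ S[(p : ℤ)] := fun n ↦ inf_le_inf_right _ (hmono n)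
  have hcmono : Monotone fun n ↦ Nat.card ↥(A n ⊓ S[(p : ℤ)]) := monotone_nat_of_le_succ fun n ↦ by
    haveI := hfin (n + 1)
    exact AddSubgroup.card_le_of_le (hTmono n)
  obtain ⟨m, hm⟩ := Iwasawa.exists_forall_le_eq_of_monotone_of_bounded hcmono hcard
  refine ⟨m, fun n hn ↦ ?_⟩
  have heq : A n ⊓ S[(p : ℤ)] = A (n + 1) ⊓ S[(p : ℤ)] := by
    haveI := hfin (n + 1)
    refine AddSubgroup.eq_of_le_of_card_ge (hTmono n) (le_of_eq ?_)
    show Nat.card ↥(A (n + 1) ⊓ S[(p : ℤ)]) = Nat.card ↥(A n ⊓ S[(p : ℤ)])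
    rw [hm (n + 1) (Nat.le_succ_of_le hn), hm n hn]
  exact le_of_inf_torsionBy_le_of_pDivisible p (hmono n) (hprim (n + 1)) (hdiv n)
    (by rw [← heq]; exact inf_le_left)

/-- The `p`-torsion of an injective image: `f(D) ⊓ S[p] = f(D ⊓ L[p])` for an injective `f : L → S`. [folklore] -/
theorem map_inf_torsionBy_eq_of_injective {L : Type*} [AddCommGroup L] (f : L →+ S)
    (hf : Function.Injective f) (D : AddSubgroup L) :
    D.map f ⊓ S[(p : ℤ)] = (D ⊓ L[(p : ℤ)]).map f := by
  ext x
  constructor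
  · intro hx
    obtain ⟨hx₁, hx₂⟩ := AddSubgroup.mem_inf.mp hx
    obtain ⟨d, hd, rfl⟩ := AddSubgroup.mem_map.mp hx₁
    have hpd : p • f d = 0 := AddSubgroup.torsionBy.nsmul_iff.mp hx₂
    refine AddSubgroup.mem_map.mpr ⟨d, AddSubgroup.mem_inf.mpr ⟨hd, AddSubgroup.torsionBy.nsmul_iff.mpr ?_⟩, rfl⟩
    apply hf
    rw [map_nsmul, hpd, map_zero]
  · intro hx
    obtain ⟨d, hd, rfl⟩ := AddSubgroup.mem_map.mp hx
    obtain ⟨hdD, hdp⟩ := AddSubgroup.mem_inf.mp hd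
    have hpd : p • d = 0 := AddSubgroup.torsionBy.nsmul_iff.mp hdp
    refine AddSubgroup.mem_inf.mpr ⟨AddSubgroup.mem_map.mpr ⟨d, hdD, rfl⟩, AddSubgroup.torsionBy.nsmul_iff.mpr ?_⟩
    rw [← map_nsmul, hpd, map_zero]

/-- The `p`-torsion of a subgroup of a group with finite `p`-torsion is finite. [folklore] -/
theorem finite_torsionBy_coe_addSubgroup {L : Type*} [AddCommGroup L] (D : AddSubgroup L)
    [Finite (L[(p : ℤ)])] : Finite ((↥D)[(p : ℤ)]) := by
  haveI : Finite ↥(D ⊓ L[(p : ℤ)]) :=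
    Finite.of_injective (AddSubgroup.inclusion inf_le_right) (AddSubgroup.inclusion_injective _)
  apply Nat.finite_of_card_ne_zero
  rw [Literature.Algebra.Module.natCard_torsionBy_addSubgroup D (p : ℤ)]
  exact Nat.card_pos.ne'

/-- **`#(D ⊓ L[p]) = p ^ corank_{ℤ_p} D` for a `p`-divisible subgroup `D` of `p`-primary elements with finite `p`-torsion** (the tree's
`pow_zpCorank_mul_natCard_modN` with `D/pD = 0`). [folklore] -/
theorem natCard_inf_torsionBy_eq_pow_zpCorank [Fact p.Prime] {L : Type*} [AddCommGroup L] (D : AddSubgroup L)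
    (hprim : ∀ d ∈ D, ∃ k : ℕ, p ^ k • d = 0) (hdiv : ∀ d ∈ D, ∃ d' ∈ D, p • d' = d)
    [Finite (L[(p : ℤ)])] : Nat.card ↥(D ⊓ L[(p : ℤ)]) = p ^ zpCorank (↥D) p := by
  haveI := finite_torsionBy_coe_addSubgroup p D
  rw [← Literature.Algebra.Module.natCard_torsionBy_addSubgroup D (p : ℤ)]
  have hprim' : ∀ d : ↥D, ∃ k : ℕ, p ^ k • d = 0 := fun d ↦ by
    obtain ⟨k, hk⟩ := hprim d d.2
    exact ⟨k, Subtype.ext (by rw [AddSubgroupClass.coe_nsmul, hk, ZeroMemClass.coe_zero])⟩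
  have h := pow_zpCorank_mul_natCard_modN (A := ↥D) (p := p) hprim'
  haveI : Subsingleton (ModN (↥D) p) := by
    have hzero : ∀ x : ↥D, (Submodule.Quotient.mk x : ModN (↥D) p) = 0 := fun x ↦ by
      rw [Submodule.Quotient.mk_eq_zero, LinearMap.mem_range]
      obtain ⟨d', hd', hd'eq⟩ := hdiv x x.2
      exact ⟨⟨d', hd'⟩, Subtype.ext (by rw [LinearMap.lsmul_apply, natCast_zsmul, AddSubgroupClass.coe_nsmul]; exact hd'eq)⟩
    refine ⟨fun x y ↦ ?_⟩
    obtain ⟨x, rfl⟩ := Submodule.Quotient.mk_surjective _ x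
    obtain ⟨y, rfl⟩ := Submodule.Quotient.mk_surjective _ y
    rw [hzero x, hzero y]
  rw [Nat.card_of_subsingleton (0 : ModN (↥D) p), mul_one] at h
  exact h.symm

/-- `corank_{ℤ_p} D = corank_{ℤ_p} L` for a subgroup `D` of finite index in a `p`-primary group `L` with finite `p`-torsion (the tree's
`zpCorank_eq_of_shortExact_of_finite_right` on `0 → D → L → L/D → 0`). [folklore] -/
theorem zpCorank_addSubgroup_eq_of_finite_quotient [Fact p.Prime] {L : Type*} [AddCommGroup L] (D : AddSubgroup L)
    (hprim : ∀ x : L, ∃ k : ℕ, p ^ k • x = 0) [Finite (L[(p : ℤ)])] [Finite (L ⧸ D)] :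
    zpCorank (↥D) p = zpCorank L p :=
  zpCorank_eq_of_shortExact_of_finite_right (i := D.subtype) (f := QuotientAddGroup.mk' D)
    (fun _ _ h ↦ Subtype.ext h) (QuotientAddGroup.mk'_surjective D)
    (fun b hb ↦ ⟨⟨b, by rwa [QuotientAddGroup.mk'_apply, QuotientAddGroup.eq_zero_iff] at hb⟩, rfl⟩)
    (fun a ↦ by rw [QuotientAddGroup.mk'_apply, QuotientAddGroup.eq_zero_iff]; exact a.2) hprim

end Algebra

/-! ## §2 The tree's layers: Cassels–Tate pairing displayed, stationarity / bounded corank in place of torsion -/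

section Tower

variable {K : Type u} [Field K] [NumberField K] (W : WeierstrassCurve K) [W.IsElliptic] {p : ℕ} [Fact p.Prime]
  (κ : ZpExtension K p) {γ : Field.absoluteGaloisGroup K}

omit [W.IsElliptic] in
/-- Divisible elements are carried to divisible elements by any additive map between layers (used for `res_{K_{n+1}/K_n}` and for
`conj_γ`). [folklore] -/
theorem map_divisibleElements_le {A B : Type*} [AddCommGroup A] [AddCommGroup B] (f : A →+ B) :
    (AddSubgroup.divisibleElements A).map f ≤ AddSubgroup.divisibleElements B := by
  intro x hx
  obtain ⟨d, hd, rfl⟩ := AddSubgroup.mem_map.mp hx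
  rw [AddSubgroup.mem_divisibleElements_iff] at hd ⊢
  intro n hn
  obtain ⟨y, rfl⟩ := hd n hn
  exact ⟨f y, (map_nsmul f n y).symm⟩

/-- **Hachimori–Matsuno on the tree's plain Selmer tower with the STATIONARITY of the divisible parts displayed (no torsion, no
finite-generation hypothesis on `X`).** For ANY number field `K`, elliptic `W/K` with `E(K)[p] = 0` (`hK`), ANY `ℤ_p`-extension `κ` with
topological generator `γ`, ANY dual datum `D : W.SelmerDualData κ γ`: if each layer `Sel_{p^∞}(E/K_n)` carries a biadditive `ℚ/ℤ`-pairing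
which is (ALT) alternating, (KER) has right kernel exactly the divisible elements, (GAL) is `conj_γ`-invariant and (ADJ) makes restriction
adjoint to the tree's corestriction `coresLayer`, AND the images `res_∞(Sel_{p^∞}(E/K_n)_{div}) ⊆ H¹(K_∞, E[p^∞])` stop growing from some
`m` on (`hst`), then `D.X` has no non-zero finite `Λ`-submodule. This is GEN 21's `forall_finite_eq_bot_of_towerPackage` with `D_n :=` the
divisible elements: `p`-divisibility of `D_n` and representability of the characters of `Sel_n/D_n` from the tree's §1 algebra of
`…OfCasselsTateAlternating` (`Sel_n` is `p`-primary with finite `p`-torsion), `conj_γ`-stability because `conj_γ` is additive on the layer,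
corestrictions by `coresLayer` / `layerToInfty_coresLayer`. [cite: HachimoriMatsuno2000, Theorem and Corollary (i), proof p. 2540 L28–L45]
[cite: KitajimaOtsuki2018, Prop. 4.1, Thm. 4.5 (arXiv:1607.03612 p. 18)] [cite: MilneADT2006, I Thm. 6.13, Rem. 6.10] -/
theorem SelmerDualData.forall_finite_eq_bot_of_casselsTateAlternating_of_stationary (hγ : κ.IsTopGenerator γ)
    (hK : ∀ P : W.toAffine.Point, p • P = 0 → P = 0) (D : W.SelmerDualData κ γ)
    (pair : ∀ n, W.selmerLayer κ n →+ W.selmerLayer κ n →+ AddCircle (1 : ℚ))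
    (halt : ∀ n (x : W.selmerLayer κ n), pair n x x = 0)
    (hker : ∀ n (t : W.selmerLayer κ n), (∀ y, pair n y t = 0) ↔ t ∈ AddSubgroup.divisibleElements (W.selmerLayer κ n))
    (hinv : ∀ n (y t y' t' : W.selmerLayer κ n),
      (y' : W.subgroupH1 p (κ.layerSubgroup n)) = W.conjH1 p (κ.layerSubgroup n) γ y →
      (t' : W.subgroupH1 p (κ.layerSubgroup n)) = W.conjH1 p (κ.layerSubgroup n) γ t → pair n y' t' = pair n y t)
    (hadj : ∀ n (t : W.selmerLayer κ (n + 1)) (t' : W.selmerLayer κ n)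
      (y : W.selmerLayer κ n) (y' : W.selmerLayer κ (n + 1)),
      (t' : W.subgroupH1 p (κ.layerSubgroup n)) = W.coresLayer p κ n (t : W.subgroupH1 p (κ.layerSubgroup (n + 1))) →
      (y' : W.subgroupH1 p (κ.layerSubgroup (n + 1))) = W.resOfLe p (κ.layerSubgroup_antitone (Nat.le_succ n)) y →
      pair n y t' = pair (n + 1) y' t)
    (hst : ∃ m : ℕ, ∀ n, m ≤ n → ∀ d ∈ AddSubgroup.divisibleElements (W.selmerLayer κ (n + 1)),
      ∃ d₀ ∈ AddSubgroup.divisibleElements (W.selmerLayer κ n),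
        W.layerToInfty κ (n + 1) (d : W.subgroupH1 p (κ.layerSubgroup (n + 1))) = W.layerToInfty κ n d₀) :
    ∀ M : Submodule (IwasawaAlgebra p) D.X, Finite M → M = ⊥ := by
  obtain ⟨m, hDst⟩ := hst
  -- §1 algebra of `…OfCasselsTateAlternating`: `p`-divisibility of the kernel and representability of characters
  have halg : ∀ n, (∀ t : W.selmerLayer κ n, (∀ y, pair n y t = 0) → ∃ t', (∀ y, pair n y t' = 0) ∧ p • t' = t) ∧
      ∀ g : W.selmerLayer κ n →+ AddCircle (1 : ℚ), (∀ t, (∀ y, pair n y t = 0) → g t = 0) →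
        ∃ c, ∀ y, g y = pair n y c := fun n ↦ by
    haveI := finite_torsionBy_selmerLayer W (p := p) κ n
    exact exists_forall_eq_pair_of_alternating_of_ker p (exists_pow_nsmul_eq_zero_selmerLayer W κ n) (pair n)
      (halt n) (hker n)
  refine SelmerDualData.forall_finite_eq_bot_of_towerPackage W κ hγ hK D
    (fun n ↦ AddSubgroup.divisibleElements (W.selmerLayer κ n)) pair m ?_ ?_ ?_ hDst
    (fun n t ht ↦ (hker n t).mp ht) (fun n t ht ↦ (hker n t).mpr ht) ?_ hinv
  · -- corestrictions: the tree's `coresLayer`, realising the norm, adjoint to restriction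
    intro n t
    exact ⟨⟨W.coresLayer p κ n (t : W.subgroupH1 p (κ.layerSubgroup (n + 1))), W.coresLayer_mem_selmerLayer p κ n t.2⟩,
      W.layerToInfty_coresLayer p κ hγ n _, fun y y' hy' ↦ hadj n t _ y y' rfl hy'⟩
  · -- the divisible elements are `p`-divisible among themselves
    intro n d hd
    obtain ⟨d', hd', h⟩ := (halg n).1 d ((hker n d).mpr hd)
    exact ⟨d', (hker n d').mp hd', h⟩
  · -- `conj_γ`-stability: `conj_γ` restricts to an additive endomorphism of the layer
    intro n d d' hd hd'
    let γL : W.selmerLayer κ n →+ W.selmerLayer κ n :=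
      ((W.conjH1 p (κ.layerSubgroup n) γ).comp (W.selmerLayer κ n).subtype).codRestrict (W.selmerLayer κ n)
        fun x ↦ W.map_conjH1_selmerGroupOver_le_holds p (κ.layerSubgroup n) γ ⟨x, x.2, rfl⟩
    have hγd : γL d = d' := Subtype.ext hd'.symm
    exact map_divisibleElements_le γL ⟨d, hd, hγd⟩
  · -- every character vanishing on the divisible elements is represented
    intro n g hg
    exact (halg n).2 g fun t ht ↦ hg t ((hker n t).mp ht)

/-- ★ **Hachimori–Matsuno on the tree's plain Selmer tower with BOUNDED `ℤ_p`-CORANK in place of `Λ`-torsion** (Matsuno 2003 Prop. 4.1 /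
Kitajima–Otsuki Thm. 4.5 shape). For ANY number field `K`, elliptic `W/K` with `E(K)[p] = 0`, ANY `ℤ_p`-extension `κ` with topological
generator `γ`, ANY dual datum `D : W.SelmerDualData κ γ`: the (ALT)(KER)(GAL)(ADJ) Cassels–Tate layer pairings AND
`∃ B, ∀ n, corank_{ℤ_p} Sel_{p^∞}(E/K_n) ≤ B` (the tree's `zpCorank`) ⟹ `D.X` has no non-zero finite `Λ`-submodule. The stationarity input
of `…_of_stationary` is PROVED here: `D_n := Sel_n^{div}` is `p`-divisible with `Sel_n/D_n` finite (`finite_quot_and_isSquare_natCard_of_pairing`),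
so `#D_n[p] = p^{zpCorank D_n} = p^{zpCorank Sel_n} ≤ p^B` (§1); `layerToInfty` is injective (`E(K)[p] = 0`,
`layerToInfty_injective_of_no_pTorsion`), so the images `A_n = res_∞(D_n) ⊆ H¹(K_∞, E[p^∞])` form an increasing chain (restriction carries
divisible elements to divisible elements, `resOfLe_comp`) of `p`-divisible subgroups of `p`-primary elements with `#(A_n ⊓ H¹[p]) ≤ p^B`,
which is stationary (`exists_forall_le_antitone_of_card_inf_torsionBy_le`). In print the corank bound is Hachimori–Matsuno's use of
«`X` `Λ`-torsion» (p. 2540 L40–42); for `E/ℚ` along the cyclotomic tower it is Kato's Thm. 14.2 with Rohrlich's non-vanishing theorem, in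
every reduction type. [cite: HachimoriMatsuno2000, Theorem and Corollary (i), proof p. 2540 L28–L45] [cite: Matsuno2003, Prop. 4.1]
[cite: KitajimaOtsuki2018, Prop. 4.4, Thm. 4.5 (arXiv:1607.03612 p. 18)] [cite: MilneADT2006, I Thm. 6.13, Rem. 6.10] -/
theorem SelmerDualData.forall_finite_eq_bot_of_casselsTateAlternating_of_corankBounded (hγ : κ.IsTopGenerator γ)
    (hK : ∀ P : W.toAffine.Point, p • P = 0 → P = 0) (D : W.SelmerDualData κ γ)
    (pair : ∀ n, W.selmerLayer κ n →+ W.selmerLayer κ n →+ AddCircle (1 : ℚ))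
    (halt : ∀ n (x : W.selmerLayer κ n), pair n x x = 0)
    (hker : ∀ n (t : W.selmerLayer κ n), (∀ y, pair n y t = 0) ↔ t ∈ AddSubgroup.divisibleElements (W.selmerLayer κ n))
    (hinv : ∀ n (y t y' t' : W.selmerLayer κ n),
      (y' : W.subgroupH1 p (κ.layerSubgroup n)) = W.conjH1 p (κ.layerSubgroup n) γ y →
      (t' : W.subgroupH1 p (κ.layerSubgroup n)) = W.conjH1 p (κ.layerSubgroup n) γ t → pair n y' t' = pair n y t)
    (hadj : ∀ n (t : W.selmerLayer κ (n + 1)) (t' : W.selmerLayer κ n)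
      (y : W.selmerLayer κ n) (y' : W.selmerLayer κ (n + 1)),
      (t' : W.subgroupH1 p (κ.layerSubgroup n)) = W.coresLayer p κ n (t : W.subgroupH1 p (κ.layerSubgroup (n + 1))) →
      (y' : W.subgroupH1 p (κ.layerSubgroup (n + 1))) = W.resOfLe p (κ.layerSubgroup_antitone (Nat.le_succ n)) y →
      pair n y t' = pair (n + 1) y' t)
    (hcork : ∃ B : ℕ, ∀ n : ℕ, zpCorank (W.selmerLayer κ n) p ≤ B) :
    ∀ M : Submodule (IwasawaAlgebra p) D.X, Finite M → M = ⊥ := by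
  obtain ⟨B, hB⟩ := hcork
  have hp : p.Prime := Fact.out
  -- notation: the divisible parts `Dn n`, the maps `f n : Sel_n → H¹(K_∞, E[p^∞])`, the images `A n`
  let Dn : ∀ n, AddSubgroup (W.selmerLayer κ n) := fun n ↦ AddSubgroup.divisibleElements (W.selmerLayer κ n)
  let f : ∀ n, W.selmerLayer κ n →+ W.subgroupH1 p κ.kerSubgroup := fun n ↦
    (W.layerToInfty κ n).comp (W.selmerLayer κ n).subtype
  have hf : ∀ n (x : W.selmerLayer κ n), f n x = W.layerToInfty κ n x := fun _ _ ↦ rfl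
  let A : ℕ → AddSubgroup (W.subgroupH1 p κ.kerSubgroup) := fun n ↦ (Dn n).map (f n)
  -- the layers are `p`-primary with finite `p`-torsion; the kernel algebra of `…OfCasselsTateAlternating`
  have hprimL : ∀ n (s : W.selmerLayer κ n), ∃ k : ℕ, p ^ k • s = 0 := fun n ↦ exists_pow_nsmul_eq_zero_selmerLayer W κ n
  haveI hfinL : ∀ n, Finite ((W.selmerLayer κ n)[(p : ℤ)]) := fun n ↦ finite_torsionBy_selmerLayer W (p := p) κ n
  have hskew : ∀ n (y t : W.selmerLayer κ n), pair n y t = -pair n t y := fun n ↦ pair_eq_neg_of_alternating (pair n) (halt n)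
  have hDdiv : ∀ n, ∀ d ∈ Dn n, ∃ d' ∈ Dn n, p • d' = d := fun n d hd ↦ by
    obtain ⟨d', hd', h⟩ := (exists_forall_eq_pair_of_alternating_of_ker p (hprimL n) (pair n) (halt n) (hker n)).1 d
      ((hker n d).mpr hd)
    exact ⟨d', (hker n d').mp hd', h⟩
  -- `Sel_n / D_n` is finite (Silverman X.4.2 (b) + the pairing), hence `zpCorank D_n = zpCorank Sel_n`
  have hfinQ : ∀ n, Finite (W.selmerLayer κ n ⧸ Dn n) := fun n ↦ by
    have hkerL : ∀ a : W.selmerLayer κ n, (∀ b, pair n a b = 0) →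
        ∀ k : ℕ, a ∈ (nsmulAddMonoidHom (α := W.selmerLayer κ n) (p ^ k)).range := by
      intro a ha k
      have ha' : a ∈ AddSubgroup.divisibleElements (W.selmerLayer κ n) :=
        (hker n a).mp fun y ↦ by rw [hskew, ha y, neg_zero]
      obtain ⟨y, hy⟩ := (AddSubgroup.mem_divisibleElements_iff _ a).mp ha' (p ^ k) (pow_pos hp.pos k)
      exact ⟨y, hy⟩
    exact (finite_quot_and_isSquare_natCard_of_pairing p (hprimL n) (pair n) (halt n) hkerL).2.1
  have hcardD : ∀ n, Nat.card ↥(Dn n ⊓ (W.selmerLayer κ n)[(p : ℤ)]) ≤ p ^ B := fun n ↦ by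
    haveI := hfinQ n
    rw [natCard_inf_torsionBy_eq_pow_zpCorank p (Dn n) (fun d _ ↦ hprimL n d) (hDdiv n),
      zpCorank_addSubgroup_eq_of_finite_quotient p (Dn n) (hprimL n)]
    exact Nat.pow_le_pow_right hp.pos (hB n)
  -- the images in `H¹(K_∞, E[p^∞])`: injective (`E(K)[p] = 0`), increasing, `p`-primary, `p`-divisible, bounded `p`-torsion
  have hfinj : ∀ n, Function.Injective (f n) := fun n x y h ↦
    Subtype.ext (layerToInfty_injective_of_no_pTorsion W κ hγ hK n (by rw [← hf, ← hf, h]))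
  have hmono : ∀ n, A n ≤ A (n + 1) := by
    rintro n _ ⟨d, hd, rfl⟩
    let ι : W.selmerLayer κ n →+ W.selmerLayer κ (n + 1) :=
      ((W.resOfLe p (κ.layerSubgroup_antitone (Nat.le_succ n))).comp (W.selmerLayer κ n).subtype).codRestrict
        (W.selmerLayer κ (n + 1)) fun x ↦ W.resOfLe_mem_selmerGroupOver p _ x.2
    refine ⟨ι d, map_divisibleElements_le ι ⟨d, hd, rfl⟩, ?_⟩
    rw [hf, hf]
    exact congrArg (fun g ↦ g (d : W.subgroupH1 p (κ.layerSubgroup n)))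
      (W.resOfLe_comp_holds p (κ.kerSubgroup_le_layerSubgroup (n + 1)) (κ.layerSubgroup_antitone (Nat.le_succ n)))
  have hprimA : ∀ n, ∀ a ∈ A n, ∃ k : ℕ, p ^ k • a = 0 := by
    rintro n _ ⟨d, -, rfl⟩
    obtain ⟨k, hk⟩ := hprimL n d
    exact ⟨k, by rw [← map_nsmul, hk, map_zero]⟩
  have hdivA : ∀ n, ∀ a ∈ A n, ∃ a' ∈ A n, p • a' = a := by
    rintro n _ ⟨d, hd, rfl⟩
    obtain ⟨d', hd', rfl⟩ := hDdiv n d hd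
    exact ⟨f n d', ⟨d', hd', rfl⟩, (map_nsmul (f n) p d').symm⟩
  have hAeq : ∀ n, A n ⊓ (W.subgroupH1 p κ.kerSubgroup)[(p : ℤ)] = (Dn n ⊓ (W.selmerLayer κ n)[(p : ℤ)]).map (f n) :=
    fun n ↦ map_inf_torsionBy_eq_of_injective p (f n) (hfinj n) (Dn n)
  have hfinD : ∀ n, Finite ↥(Dn n ⊓ (W.selmerLayer κ n)[(p : ℤ)]) := fun n ↦
    Finite.of_injective (AddSubgroup.inclusion inf_le_right) (AddSubgroup.inclusion_injective _)
  have hfinA : ∀ n, Finite ↥(A n ⊓ (W.subgroupH1 p κ.kerSubgroup)[(p : ℤ)]) := fun n ↦ by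
    rw [hAeq n]
    haveI := hfinD n
    exact Finite.of_surjective _ ((f n).addSubgroupMap_surjective _)
  have hcardA : ∀ n, Nat.card ↥(A n ⊓ (W.subgroupH1 p κ.kerSubgroup)[(p : ℤ)]) ≤ p ^ B := fun n ↦ by
    rw [hAeq n, ← Nat.card_congr ((Dn n ⊓ (W.selmerLayer κ n)[(p : ℤ)]).equivMapOfInjective (f n) (hfinj n)).toEquiv]
    exact hcardD n
  -- stationarity (§1) and the criterion with stationarity displayed
  obtain ⟨m, hm⟩ := exists_forall_le_antitone_of_card_inf_torsionBy_le p A hmono hprimA hdivA hfinA hcardA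
  refine SelmerDualData.forall_finite_eq_bot_of_casselsTateAlternating_of_stationary W κ hγ hK D pair halt hker hinv hadj
    ⟨m, fun n hn d hd ↦ ?_⟩
  obtain ⟨d₀, hd₀, h⟩ := hm n hn ⟨d, hd, rfl⟩
  exact ⟨d₀, hd₀, by rw [← hf, ← hf]; exact h.symm⟩

/-- ★ **The same with the Cassels–Tate layer pairing supplied BY NAME from the Literature fact
`HachimoriMatsuno2000.casselsTate_layerPairing`** (Cassels 1962 / Silverman X.4.14 / Milne *ADT* I 6.13 + Hachimori–Matsuno p. 2540
L34–37; Galois-equivariance used only at `γ`). ANY `K`, `p`, `κ`, `γ` topological generator, `E(K)[p] = 0`,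
`∃ B, ∀ n, zpCorank (Sel_{p^∞}(E/K_n)) p ≤ B` ⟹ every dual datum has no non-zero finite `Λ`-submodule. CONDITIONAL on the named fact
(binder `hCT`); the corank bound is a displayed hypothesis. [cite: HachimoriMatsuno2000, Theorem and Corollary (i), proof p. 2540 L28–L45]
[cite: KitajimaOtsuki2018, Thm. 4.5 (arXiv:1607.03612 p. 18)] -/
theorem SelmerDualData.forall_finite_eq_bot_of_casselsTateLayerPairing_of_corankBounded
    (hCT : HachimoriMatsuno2000.casselsTate_layerPairing.{u}) (hγ : κ.IsTopGenerator γ)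
    (hK : ∀ P : W.toAffine.Point, p • P = 0 → P = 0) (D : W.SelmerDualData κ γ)
    (hcork : ∃ B : ℕ, ∀ n : ℕ, zpCorank (W.selmerLayer κ n) p ≤ B) :
    ∀ M : Submodule (IwasawaAlgebra p) D.X, Finite M → M = ⊥ := by
  obtain ⟨pair, halt, hker, hgal, hadj⟩ := hCT K W p κ
  exact SelmerDualData.forall_finite_eq_bot_of_casselsTateAlternating_of_corankBounded W κ hγ hK D pair halt hker
    (fun n ↦ hgal n γ) hadj hcork

/-- **The same with the Cassels–Tate layer pairing by name and the STATIONARITY displayed** (the weakest form of the growth input: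
`res_∞(Sel_{p^∞}(E/K_{n+1})_{div}) ⊆ res_∞(Sel_{p^∞}(E/K_n)_{div})` for `n ≥ m`). [cite: HachimoriMatsuno2000, Theorem and Corollary (i), proof p. 2540 L28–L45] -/
theorem SelmerDualData.forall_finite_eq_bot_of_casselsTateLayerPairing_of_stationary
    (hCT : HachimoriMatsuno2000.casselsTate_layerPairing.{u}) (hγ : κ.IsTopGenerator γ)
    (hK : ∀ P : W.toAffine.Point, p • P = 0 → P = 0) (D : W.SelmerDualData κ γ)
    (hst : ∃ m : ℕ, ∀ n, m ≤ n → ∀ d ∈ AddSubgroup.divisibleElements (W.selmerLayer κ (n + 1)),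
      ∃ d₀ ∈ AddSubgroup.divisibleElements (W.selmerLayer κ n),
        W.layerToInfty κ (n + 1) (d : W.subgroupH1 p (κ.layerSubgroup (n + 1))) = W.layerToInfty κ n d₀) :
    ∀ M : Submodule (IwasawaAlgebra p) D.X, Finite M → M = ⊥ := by
  obtain ⟨pair, halt, hker, hgal, hadj⟩ := hCT K W p κ
  exact SelmerDualData.forall_finite_eq_bot_of_casselsTateAlternating_of_stationary W κ hγ hK D pair halt hker
    (fun n ↦ hgal n γ) hadj hst

end Tower

end Summit.BirchSwinnertonDyer.BirchSwinnertonDyer.Theorems.TowerHaMa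

end
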